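import Mathlib
import Summits.ValiantsHypothesis.ValiantsHypothesis.Theorems.BinomialElusiveBinomialCandidateLowDegreeVanishingZero
import Summits.ValiantsHypothesis.ValiantsHypothesis.Theorems.BinomialElusiveBinomialCandidateCrossCapEliminant
import Summits.ValiantsHypothesis.ValiantsHypothesis.Theorems.BinomialElusiveBinomialCandidateCrossCapEvaluation
import Summits.ValiantsHypothesis.ValiantsHypothesis.Theorems.BinomialElusiveBinomialCandidateCrossCapIteration
import Summits.ValiantsHypothesis.ValiantsHypothesis.Theorems.BinomialElusiveBinomialCandidateCrossCapNormalForm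

/-!
# Crux `BinomialElusive.BinomialCandidate` (stmt-ValiantsHypothesis-7392), line `registered` —
# stub `stub_crossCap`: cross-cap base points are impossible for E-type data

The registered stub `stub_crossCap` of skeleton v3: an integral formal solution `p` of
`Γ(p) = T`, `T_i = t^{N a_i} + t^{N b_i}`, whose base point `y₀ = p(0)` has a corank-one
Jacobian with kernel `ℂκ` and satisfies the cross-cap condition `B(κ,κ) ∉ Im dΓ(y₀)`, cannot
exist when the exponents have (P1) no relation of length `≤ 4` and (P2) a congruence modulus.

Proof (assembly of the landed pieces):
1. `crossCap_normalForm` — coordinates `P` (target), `S` (source, `S e_0 = κ`): polynomials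
   `B_i` without monomials of degree `< 2` and series `q` of positive order with
   `q_j + B_{j+1}(q) = T̂_{j+1}`, `B_0(q) = T̂_0`, `B_1(q) = T̂_1` (`T̂ = P T`) and
   `(c₀, c₁) := (coeff_{Y_0²} B_0, coeff_{Y_0²} B_1) ≠ 0`;
2. `crossCap_iteration` — polynomials `F₀, F₁ ∈ ℂ[W][X]` with `F_a(T̂, q_0) ≡ 0 (mod t^G)` and
   controlled low coefficients;
3. `crossCap_eliminant` — Weierstrass division in `ℂ⟦W⟧⟦X⟧` by `F₀` (if `c₀ ≠ 0`; else by `F₁`):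
   `D ∈ (F₀, F₁) ∩ ℂ⟦W⟧` with `D(0) = 0` and a nonzero coefficient of degree `2`;
4. `crossCap_evaluation` — `D_{<G}(T̂) ≡ 0 (mod t^G)`;
5. transfer to the binomials, `ψ(W) := D_{<G}(P W)`, and `lowDegreeVanishing_zero` ((P1), (P2)):
   all coefficients of `ψ` of degree `≤ 2` vanish, hence (undoing `P`) those of `D_{<G}` —
   contradiction.
-/

-- layout Summits/ValiantsHypothesis/ValiantsHypothesis forces the duplicated namespace component
set_option linter.dupNamespace false

noncomputable section

namespace Summit.ValiantsHypothesis.ValiantsHypothesis.Theorems.BinomialCandidateStubs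

open scoped BigOperators
open MvPolynomial

namespace CrossCap

variable {m : ℕ}

/-- Coefficients of the embedding `ℂ[W][X] → ℂ⟦W⟧⟦X⟧`. -/
theorem coeff_coePoly (F : Polynomial (MvPolynomial (Fin m) ℂ)) (j : ℕ) :
    PowerSeries.coeff j ((F.map MvPolynomial.coeToMvPowerSeries.ringHom :
      Polynomial (MvPowerSeries (Fin m) ℂ)) : PowerSeries (MvPowerSeries (Fin m) ℂ)) =
      ↑(F.coeff j) := by
  simp [Polynomial.coeff_coe]

/-- Constant coefficients through the embedding. -/
theorem constantCoeff_coePoly (F : Polynomial (MvPolynomial (Fin m) ℂ)) (j : ℕ) :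
    MvPowerSeries.constantCoeff (PowerSeries.coeff j ((F.map MvPolynomial.coeToMvPowerSeries.ringHom :
      Polynomial (MvPowerSeries (Fin m) ℂ)) : PowerSeries (MvPowerSeries (Fin m) ℂ))) =
      MvPolynomial.constantCoeff (F.coeff j) := by
  rw [coeff_coePoly, ← MvPowerSeries.coeff_zero_eq_constantCoeff_apply, MvPolynomial.coeff_coe,
    MvPolynomial.constantCoeff_eq]

/-- Linear coefficients through the embedding. -/
theorem coeff_single_coePoly (F : Polynomial (MvPolynomial (Fin m) ℂ)) (j : ℕ) (i : Fin m) :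
    MvPowerSeries.coeff (Finsupp.single i 1) (PowerSeries.coeff j
      ((F.map MvPolynomial.coeToMvPowerSeries.ringHom :
        Polynomial (MvPowerSeries (Fin m) ℂ)) : PowerSeries (MvPowerSeries (Fin m) ℂ))) =
      MvPolynomial.coeff (Finsupp.single i 1) (F.coeff j) := by
  rw [coeff_coePoly, MvPolynomial.coeff_coe]

/-- Binomials of positive exponents have positive order. -/
theorem vanish_binomial {N : ℕ} {a b : ℕ} (ha : 1 ≤ a) (hb : 1 ≤ b) (hN : 0 < N) :
    ∀ g : ℤ, g < 1 → (HahnSeries.single ((N * a : ℕ) : ℤ) (1 : ℂ) +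
      HahnSeries.single ((N * b : ℕ) : ℤ) (1 : ℂ) : LaurentSeries ℂ).coeff g = 0 := by
  intro g hg
  have h1 : (1 : ℤ) ≤ ((N * a : ℕ) : ℤ) := by exact_mod_cast Nat.mul_pos hN ha
  have h2 : (1 : ℤ) ≤ ((N * b : ℕ) : ℤ) := by exact_mod_cast Nat.mul_pos hN hb
  rw [HahnSeries.coeff_add', Pi.add_apply, HahnSeries.coeff_single_of_ne (by omega),
    HahnSeries.coeff_single_of_ne (by omega), add_zero]

end CrossCap

open CrossCap JetReduction in
/-- **Stub `stub_crossCap`** of line `registered` (skeleton v3) of the crux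
`BinomialElusive.BinomialCandidate`: a corank-one cross-cap integral base point is impossible
for exponent data with (P1) no relation of length `≤ 4` and (P2) a congruence modulus. -/
theorem stub_crossCap :
    ∀ m ≥ 2, ∀ (a b : Fin m → ℕ) (Γ : Fin m → MvPolynomial (Fin (m - 1)) ℂ) (N : ℕ)
      (p : Fin (m - 1) → LaurentSeries ℂ), (∀ i, (Γ i).totalDegree ≤ 2) → 0 < N →
      (∀ j, 0 ≤ (p j).order) →
      (∀ i, 1 ≤ a i ∧ 1 ≤ b i) →
      (∀ u v : Fin m → ℤ, ∑ i, (|u i| + |v i|) ≤ 4 → ∑ i, (u i * (a i : ℤ) + v i * (b i : ℤ)) = 0 → (u, v) = 0) →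
      (∃ M' : ℕ, (∀ i, a i % M' = 1 ∧ b i % M' = 1) ∧
        (∀ i j, 2 * a i < M' * a j ∧ 2 * a i < M' * b j ∧ 2 * b i < M' * a j ∧ 2 * b i < M' * b j)) →
      ∀ κ : Fin (m - 1) → ℂ, κ ≠ 0 →
        (∀ i, ∑ j, κ j * MvPolynomial.eval (fun l => (p l).coeff 0) (MvPolynomial.pderiv j (Γ i)) = 0) →
        (∀ κ' : Fin (m - 1) → ℂ,
          (∀ i, ∑ j, κ' j * MvPolynomial.eval (fun l => (p l).coeff 0) (MvPolynomial.pderiv j (Γ i)) = 0) →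
          ∃ μ : ℂ, κ' = μ • κ) →
        (¬ ∃ v : Fin (m - 1) → ℂ, ∀ i, MvPolynomial.eval κ (MvPolynomial.homogeneousComponent 2 (Γ i)) =
          ∑ j, v j * MvPolynomial.eval (fun l => (p l).coeff 0) (MvPolynomial.pderiv j (Γ i))) →
        (∀ i, MvPolynomial.aeval p (Γ i) =
          HahnSeries.single ((N * a i : ℕ) : ℤ) (1 : ℂ) + HahnSeries.single ((N * b i : ℕ) : ℤ) (1 : ℂ)) →
        False := by
  intro m hm a b Γ N p hΓ hN hp hab hP1 hP2 κ hκ hker hcorank hcross hsol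
  obtain ⟨n₀, rfl⟩ : ∃ n₀, m = n₀ + 2 := ⟨m - 2, by omega⟩
  classical
  -- the binomials and their level
  set T : Fin (n₀ + 2) → LaurentSeries ℂ := fun i =>
    HahnSeries.single ((N * a i : ℕ) : ℤ) (1 : ℂ) + HahnSeries.single ((N * b i : ℕ) : ℤ) (1 : ℂ) with hTdef
  have hT : ∀ i, ∀ g : ℤ, g < 1 → (T i).coeff g = 0 := fun i =>
    vanish_binomial (hab i).1 (hab i).2 hN
  set G : ℕ := 2 * N * ∑ i, (a i + b i) + 1 with hGdef
  have hGbound : ∀ i, 2 * ((N * a i : ℕ) : ℤ) < G ∧ 2 * ((N * b i : ℕ) : ℤ) < G := by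
    intro i
    have hi : a i + b i ≤ ∑ i, (a i + b i) :=
      Finset.single_le_sum (f := fun i => a i + b i) (fun _ _ => Nat.zero_le _) (Finset.mem_univ i)
    have h1 : 2 * (N * a i) < G := by rw [hGdef]; nlinarith
    have h2 : 2 * (N * b i) < G := by rw [hGdef]; nlinarith
    exact ⟨by exact_mod_cast h1, by exact_mod_cast h2⟩
  have hG2 : 2 < G := by
    have := (hGbound 0).1
    have h1 : (1 : ℤ) ≤ ((N * a 0 : ℕ) : ℤ) := by exact_mod_cast Nat.mul_pos hN (hab 0).1
    omega
  -- 1. normal form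
  obtain ⟨P, P', B, q, hPP', hP'P, hB, hq, hreg, h0, h1, hc⟩ :=
    crossCap_normalForm n₀ Γ p T κ hΓ hp hT hsol hκ hker hcorank hcross
  set Th : Fin (n₀ + 2) → LaurentSeries ℂ := fun i => ∑ i', algebraMap ℂ (LaurentSeries ℂ) (P i i') * T i'
    with hThdef
  have hTh : ∀ i, ∀ g : ℤ, g < 1 → (Th i).coeff g = 0 := fun i =>
    vanish_sum _ _ fun i' _ => by simpa using vanish_mul (vanish_algebraMap (P i i')) (hT i')
  -- 2. elimination of the regular coordinates
  obtain ⟨F₀, F₁, hev0, hev1, h00, h01, h02, h10, h11, h12, l00, l01, l10, l11⟩ :=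
    crossCap_iteration n₀ G B q Th hB hq hTh hreg h0 h1
  -- 3./4. the eliminant and its evaluation
  have main : ∃ (D : MvPowerSeries (Fin (n₀ + 2)) ℂ) (i : Fin (n₀ + 2)),
      MvPowerSeries.constantCoeff D = 0 ∧ MvPowerSeries.coeff (Finsupp.single i 2) D ≠ 0 ∧
      ∀ g : ℤ, g < G → (MvPolynomial.aeval Th (MvPowerSeries.truncTotal G D)).coeff g = 0 := by
    rcases hc with hc0 | hc1
    · obtain ⟨D, U, V, hD, hD0, hDi⟩ := crossCap_eliminant (n₀ + 2)
        ((F₀.map MvPolynomial.coeToMvPowerSeries.ringHom : Polynomial (MvPowerSeries (Fin (n₀ + 2)) ℂ)) :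
          PowerSeries (MvPowerSeries (Fin (n₀ + 2)) ℂ))
        ((F₁.map MvPolynomial.coeToMvPowerSeries.ringHom : Polynomial (MvPowerSeries (Fin (n₀ + 2)) ℂ)) :
          PowerSeries (MvPowerSeries (Fin (n₀ + 2)) ℂ)) 1
        (by rw [constantCoeff_coePoly]; exact h00) (by rw [constantCoeff_coePoly]; exact h01)
        (by rw [constantCoeff_coePoly, h02]; exact hc0)
        (by rw [constantCoeff_coePoly]; exact h10) (by rw [constantCoeff_coePoly]; exact h11)
        (by
          rw [constantCoeff_coePoly, constantCoeff_coePoly, coeff_single_coePoly, coeff_single_coePoly,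
            h02, l11, l01, mul_zero, mul_neg_one, neg_ne_zero]
          exact hc0)
      exact ⟨D, 1, hD0, hDi, crossCap_evaluation (n₀ + 2) G F₀ F₁ D U V Th (q 0) hD hTh (hq 0) hev0 hev1⟩
    · obtain ⟨D, U, V, hD, hD0, hDi⟩ := crossCap_eliminant (n₀ + 2)
        ((F₁.map MvPolynomial.coeToMvPowerSeries.ringHom : Polynomial (MvPowerSeries (Fin (n₀ + 2)) ℂ)) :
          PowerSeries (MvPowerSeries (Fin (n₀ + 2)) ℂ))
        ((F₀.map MvPolynomial.coeToMvPowerSeries.ringHom : Polynomial (MvPowerSeries (Fin (n₀ + 2)) ℂ)) :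
          PowerSeries (MvPowerSeries (Fin (n₀ + 2)) ℂ)) 0
        (by rw [constantCoeff_coePoly]; exact h10) (by rw [constantCoeff_coePoly]; exact h11)
        (by rw [constantCoeff_coePoly, h12]; exact hc1)
        (by rw [constantCoeff_coePoly]; exact h00) (by rw [constantCoeff_coePoly]; exact h01)
        (by
          rw [constantCoeff_coePoly, constantCoeff_coePoly, coeff_single_coePoly, coeff_single_coePoly,
            h12, l00, l10, mul_zero, mul_neg_one, neg_ne_zero]
          exact hc1)
      exact ⟨D, 0, hD0, hDi, crossCap_evaluation (n₀ + 2) G F₁ F₀ D U V Th (q 0) hD hTh (hq 0) hev1 hev0⟩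
  obtain ⟨D, i, hD0, hDi, hDev⟩ := main
  -- 5. transfer to the binomials
  set D' : MvPolynomial (Fin (n₀ + 2)) ℂ := MvPowerSeries.truncTotal G D with hD'def
  set ψ : MvPolynomial (Fin (n₀ + 2)) ℂ := aeval (fun i => ∑ i', C (P i i') * X i') D' with hψdef
  have hψT : aeval T ψ = aeval Th D' := by
    have hfun : (fun i => aeval T (∑ i', C (P i i') * X i')) = Th := by
      funext i; rw [aeval_linear]
    rw [hψdef, aeval_aeval, hfun]
  have hD'1 : ∀ d : Fin (n₀ + 2) →₀ ℕ, d.degree < 1 → coeff d D' = 0 := by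
    intro d hd
    have hd0 : d = 0 := (Finsupp.degree_eq_zero_iff d).mp (by omega)
    rw [hd0, hD'def, MvPowerSeries.coeff_truncTotal _ (by simp; omega),
      MvPowerSeries.coeff_zero_eq_constantCoeff_apply, hD0]
  have lin_mem : ∀ (M : Matrix (Fin (n₀ + 2)) (Fin (n₀ + 2)) ℂ) (i : Fin (n₀ + 2)),
      ∀ d : Fin (n₀ + 2) →₀ ℕ, d.degree < 1 → coeff d (∑ i', C (M i i') * X i') = 0 := fun M i =>
    degGE_sum _ fun l _ => degGE_C_mul _ (degGE_X l)
  have hψcc : MvPolynomial.constantCoeff ψ = 0 := by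
    rw [MvPolynomial.constantCoeff_eq]
    exact aeval_degGE hD'1 (lin_mem P) 0 (by simp)
  have hlow := lowDegreeVanishing_zero (n₀ + 2) a b N hN hP1 hP2 ψ G hψcc hGbound
    (fun g hg => by rw [hψT]; exact hDev g hg)
  have hψ3 : ∀ d : Fin (n₀ + 2) →₀ ℕ, d.degree < 3 → coeff d ψ = 0 := by
    intro d hd
    refine hlow d ?_
    have : (d.sum fun _ e => e) = d.degree := by rw [Finsupp.degree_apply]; rfl
    omega
  -- undo `P`
  have hback : aeval (fun i => ∑ l, C (P' i l) * X l) ψ = D' := by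
    rw [hψdef, aeval_aeval]
    have : (fun i => aeval (fun i => ∑ l, C (P' i l) * X l) (∑ i', C (P i i') * X i')) =
        fun i => (X i : MvPolynomial (Fin (n₀ + 2)) ℂ) := by
      funext i
      rw [aeval_linear, MvPolynomial.algebraMap_eq, sum_C_mul_linear]
      exact linear_eq_X_of_mul_eq_one hPP' i
    rw [this, aeval_X_left, AlgHom.id_apply]
  have hD'3 : ∀ d : Fin (n₀ + 2) →₀ ℕ, d.degree < 3 → coeff d D' = 0 := by
    rw [← hback]
    exact aeval_degGE hψ3 (lin_mem P')
  have := hD'3 (Finsupp.single i 2) (by simp)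
  rw [hD'def, MvPowerSeries.coeff_truncTotal _ (by simp; omega)] at this
  exact hDi this

end Summit.ValiantsHypothesis.ValiantsHypothesis.Theorems.BinomialCandidateStubs

end
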